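import Summits.CriticalPhenomena.SAWScalingLimit.Theorems.SAWRenewalTightnessRoomPassageDefs
import Literature.Probability.RandomPlanarGeometry.LatticeSlitStemCapacity
import Literature.Probability.RandomPlanarGeometry.SelfAvoidingWalk
import HarnessLib

/-!
# Conjunct (2b) of `SAWLatticeDrivers`: the stem capacity of every SAW past `γ[0, 0]` vanishes
(crux `SubseqIdentification`, stmt-CriticalPhenomena-0783; line `room-entropy-wright-fisher`,
stub `stub_sawLatticeDrivers`, continuation seat c1)

The named statement `SAWLatticeDrivers` of the line skeleton
`Cruxes/SubseqIdentification/Lines/room_entropy_wright_fisher.lean` (r6b) has as its third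
conjunct: for every `ε > 0`, for all small meshes `δ`, EVERY self-avoiding walk `γ` of `Ω_δ` from
`a_δ` to `b_δ` has `LatticeSlit.capTime φ (prefixAt γ 0) ≤ ε` — the past `γ[0, 0]` is the trivial
walk, whose hull is the closed stem of `z₀ = φ⁻¹(δ a_δ)` (`LatticeSlit.pastSet_of_nil`), of
capacity time `≤ 144 |z₀|²` (`LatticeSlit.capTime_le_of_nil`, Lawler (2005) (3.9)), and
`z₀ → 0` by the boundary continuity of `φ⁻¹` at `a = φ(0)` (Carathéodory). This file PROVES that
conjunct as the standalone theorem `stub_sawLatticeDriversStemCapacity` (from the tree's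
`LatticeSlit.eventually_capTime_le_of_nil`), together with the fact about endpoint
approximations it needs: `δ · a_δ ∈ D` eventually (`eventually_meshPoint_fst_mem`: the
endpoints are eventually distinct and joined in `Ω_δ`).

(The first two conjuncts of `SAWLatticeDrivers` — a continuous driver of ALL pasts of EVERY walk
through the fixed stem — fail for walks crossing their stem; see
`Literature/Probability/RandomPlanarGeometry/LatticeSlitSwallowedSteps.lean` for the mechanism:
a step inside a swallowed pocket keeps the hull and the capacity time but has driving value `0`.)

References: G. F. Lawler, *Conformally Invariant Processes in the Plane* (2005), §3.4 (3.9),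
§4.1; Ch. Pommerenke, *Boundary Behaviour of Conformal Maps* (1992), Thm. 2.6.
-/

noncomputable section

open MeasureTheory Filter Topology Set
open scoped NNReal ENNReal Classical BigOperators
open Literature.Probability.LatticeModels
open Literature.Probability.RandomPlanarGeometry
open UpperHalfPlane (upperHalfPlaneSet)

namespace Summit.CriticalPhenomena.SAWScalingLimit.Theorems.SubseqIdentification.RoomEntropy

/-- A vertex joined in `Ω_δ` to a DIFFERENT vertex is a vertex of the discrete domain, so its
mesh point lies in `Ω` (the first edge of a joining walk is an edge of `Ω_δ`). [folklore] -/
theorem meshPoint_mem_of_reachable_ne {Ω : Set ℂ} {δ : ℝ} {u v : Site 2}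
    (h : (discreteDomainGraph Ω δ).Reachable u v) (huv : u ≠ v) : meshPoint δ u ∈ Ω := by
  obtain ⟨p⟩ := h
  cases p with
  | nil => exact absurd rfl huv
  | cons hadj _ =>
    exact meshDomain_subset_meshVertices Ω δ (discreteDomainGraph_adj_iff.1 hadj).2.1

/-- **`δ · a_δ ∈ D` for all small `δ`** under the endpoint hypothesis (reachability of `b_δ`
from `a_δ ≠ b_δ`). [folklore] -/
theorem eventually_meshPoint_fst_mem {D : DobrushinDomain} {a b : ℝ → Site 2}
    (hab : SAW.IsEndpointApprox D a b) :
    ∀ᶠ δ in 𝓝[>] (0 : ℝ), meshPoint δ (a δ) ∈ D.carrier := by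
  -- the endpoints are eventually distinct (`δ · a_δ → a ≠ b ← δ · b_δ`; cf. the tree's
  -- `IsingBoundaryRatio.Negative.eventually_ne`, not imported here)
  have hpt : D.pt 0 ≠ D.pt 1 := fun h => absurd (D.pt_injective h) (by decide)
  obtain ⟨U, V, hU, hV, h0, h1, hUV⟩ := t2_separation hpt
  filter_upwards [hab.reachable, hab.tendsto_fst (hU.mem_nhds h0),
    hab.tendsto_snd (hV.mem_nhds h1)] with δ hr hδ0 hδ1
  have hδ0' : meshPoint δ (a δ) ∈ U := hδ0
  have hδ1' : meshPoint δ (b δ) ∈ V := hδ1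
  refine meshPoint_mem_of_reachable_ne hr fun heq ↦ ?_
  rw [heq] at hδ0'
  exact Set.disjoint_left.1 hUV hδ0' hδ1'

/-- The past `γ[0, 0]` is a trivial walk. [folklore] -/
theorem prefixAt_zero_nil {Ω : Set ℂ} {δ : ℝ} {a b : Site 2} (γ : SAW.DomainSAW Ω δ a b) :
    (prefixAt γ 0).Nil :=
  (SimpleGraph.Walk.nil_takeUntil _ _).2 (SimpleGraph.Walk.getVert_zero _).symm

/-- **Conjunct (2b) of `SAWLatticeDrivers`: the stem capacity vanishes uniformly.** For every
Dobrushin domain, endpoint approximation and chordal uniformizing map `φ`, and every `ε > 0`: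
for all small `δ > 0`, every SAW `γ` of `Ω_δ` from `a_δ` to `b_δ` has
`LatticeSlit.capTime φ (prefixAt γ 0) ≤ ε` (`t_{γ[0,0]} ≤ 144 |φ⁻¹(δ a_δ)|² → 0`).
[cite: Lawler2005, §4.1 (capacity parametrisation) with §3.4 (3.9)] -/
theorem stub_sawLatticeDriversStemCapacity :
    ∀ (D : DobrushinDomain) (a b : ℝ → Site 2) (φ : ConformalEquiv upperHalfPlaneSet D.carrier),
      SAW.IsEndpointApprox D a b → D.IsChordalUniformizing φ →
      ∀ ε : ℝ, 0 < ε → ∀ᶠ δ in 𝓝[>] (0 : ℝ), ∀ γ : SAW.DomainSAW D.carrier δ (a δ) (b δ),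
        LatticeSlit.capTime φ (prefixAt γ 0) ≤ ε := by
  intro D a b φ hab hφ ε hε
  filter_upwards [LatticeSlit.eventually_capTime_le_of_nil hφ hab.tendsto_fst
    (eventually_meshPoint_fst_mem hab) hε] with δ hδ γ
  exact hδ _ (prefixAt γ 0) (prefixAt_zero_nil γ)

end Summit.CriticalPhenomena.SAWScalingLimit.Theorems.SubseqIdentification.RoomEntropy

end
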